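import Summits.ValiantsHypothesis.ValiantsHypothesis.Theorems.KPlusLogSqLawTropicalBTowerRowTwoGenDefs

/-!
# The general `m = 2` tower design — CHAIN FACTS: each chain term has slope `Xg k`, cost `Cg k`, sign `(−1)ᵏ`

Crux `TropicalB` (stmt-ValiantsHypothesis-19771) calibration, companion of the symmetric tower design `…TowerGraftTowerRowTwoSym`
(`3K − 4`, crux `WeakLifting` 19561): the tree's exact GENERAL row `T(2, K) = 4K − 7` (`TwoRowFamily.tropRootLawAt_two_iff`, witnessed on the
near-arithmetic support `4K²·l + l²`) is ATTAINED ON EVERY 2-TOWER.  NO stub is claimed; nothing on `TropicalB` in its window, `WeakLifting`,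
`MatrixDescartes` (18050) or `VP ≠ VNP`.  Seat: prover leafhand-val-kpluslogsqlaw-1 g3, `--supports stmt-ValiantsHypothesis-19771`.
Def-free (data in `…TowerRowTwoGenDefs`).  [folklore bookkeeping]
-/

set_option linter.dupNamespace false
set_option autoImplicit false

namespace Summit.ValiantsHypothesis.ValiantsHypothesis.Theorems.KPlusLogSqLaw.TowerGraft

open Summit.ValiantsHypothesis.ValiantsHypothesis.Theorems.MatrixDescartes.Negative
open Summit.ValiantsHypothesis.ValiantsHypothesis.Theorems.LacunarySymmetroidMatrixDescartes
open Summit.ValiantsHypothesis.ValiantsHypothesis.Theorems.LacunarySymmetroidMatrixDescartes.TropicalCensus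
open Summit.ValiantsHypothesis.ValiantsHypothesis.Theorems.KPlusLogSqLaw.EnvelopeCriterion
open Summit.ValiantsHypothesis.ValiantsHypothesis.Theorems.KPlusLogSqLaw.TwoRowFamily (perm_two)
open Finset

namespace TowerRowTwoGen

open TowerRowTwoSym (dN dN_lt dN_tower dN_le dN_nonneg slope_two)

variable {K : ℕ}


/-- cost of an identity term. -/
theorem costg_id (d : Fin K → ℕ) (q : Equiv.Perm (Fin 2) × (Fin 2 → Fin K)) (h : q.1 = 1) :
    ∑ i, vg K d (q.1 i) i (q.2 i) = aG K d (q.2 0) + cG K d (q.2 1) := by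
  rw [Fin.sum_univ_two, h]; simp [vg]

/-- cost of a transposition term. -/
theorem costg_swap (d : Fin K → ℕ) (q : Equiv.Perm (Fin 2) × (Fin 2 → Fin K)) (h : q.1 = Equiv.swap 0 1) :
    ∑ i, vg K d (q.1 i) i (q.2 i) = bG K d (q.2 0) + eG K d (q.2 1) := by
  rw [Fin.sum_univ_two, h]; simp [vg]

/-- sign of an identity term. -/
theorem termSigng_id (q : Equiv.Perm (Fin 2) × (Fin 2 → Fin K)) (h : q.1 = 1) :
    termSign (εg K) q = (-1) ^ ((q.2 0 : ℕ)) *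
      (if ((q.2 1 : ℕ)) = 0 then 1 else (if ((q.2 1 : ℕ)) + 1 = K then (-1) ^ K else -1)) := by
  unfold termSign; rw [Fin.prod_univ_two, h]; simp [εg]

/-- sign of a transposition term. -/
theorem termSigng_swap (q : Equiv.Perm (Fin 2) × (Fin 2 → Fin K)) (h : q.1 = Equiv.swap 0 1) :
    termSign (εg K) q = -(εg K 1 0 (q.2 0) * εg K 0 1 (q.2 1)) := by
  unfold termSign; rw [Fin.prod_univ_two, h, Equiv.Perm.sign_swap (by decide)]
  simp only [Equiv.swap_apply_left, Equiv.swap_apply_right, Units.val_neg, Units.val_one]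
  ring

/-- the entry-`(1,0)` sign. -/
theorem εg_10 (l : Fin K) : εg K 1 0 l = if (l : ℕ) + 3 ≤ K then (-1) ^ (l : ℕ) else 0 := by
  unfold εg; rw [if_neg (by decide), if_pos rfl]

/-- the entry-`(0,1)` sign. -/
theorem εg_01 (l : Fin K) : εg K 0 1 l = if 2 ≤ (l : ℕ) then (-1) ^ (l : ℕ) else 0 := by
  unfold εg; rw [if_pos rfl, if_neg (by decide)]

/-- the signs are in `{−1, 0, 1}`. -/
theorem εg_natAbs : ∀ i j (l : Fin K), (εg K i j l).natAbs ≤ 1 := by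
  intro i j l; unfold εg
  split_ifs <;> simp [Int.natAbs_pow]

section chain
variable (hK : 3 ≤ K) (d : Fin K → ℕ)

/-- the permutation of chain term `k`. -/
theorem termg_fst (k : Fin (4 * K - 7 + 1)) : (termg K hK k).1 = permg K k := rfl
/-- column-`0` class of chain term `k`. -/
theorem termg_cls0 (k : Fin (4 * K - 7 + 1)) : (((termg K hK k).2 0 : Fin K) : ℕ) = g0 K k := rfl
/-- column-`1` class of chain term `k`. -/
theorem termg_cls1 (k : Fin (4 * K - 7 + 1)) : (((termg K hK k).2 1 : Fin K) : ℕ) = g1 K k := rfl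

include hK in
/-- a term with the chain's permutation and classes IS the chain term. -/
theorem eq_termg (q : Equiv.Perm (Fin 2) × (Fin 2 → Fin K)) (k : ℕ) (hk : k ≤ 4 * K - 7)
    (h1 : q.1 = permg K k) (h0 : ((q.2 0 : Fin K) : ℕ) = g0 K k) (h1' : ((q.2 1 : Fin K) : ℕ) = g1 K k) :
    q = termg K hK ⟨k, by omega⟩ := by
  refine Prod.ext h1 (funext fun i => ?_)
  fin_cases i
  · exact Fin.ext h0
  · exact Fin.ext h1'

/-- slope of chain term `k` is `Xg k`. -/
theorem slope_termg (k : Fin (4 * K - 7 + 1)) : TropicalCensus.slope d (termg K hK k) = Xg K d k := by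
  rw [TowerRowTwoSym.slope_two]; rfl

/-- permutation of a transposition chain term. -/
theorem permg_sw {k : ℕ} (h : isSw K k = true) : permg K k = Equiv.swap 0 1 := by unfold permg; rw [if_pos h]
/-- permutation of an identity chain term. -/
theorem permg_id {k : ℕ} (h : isSw K k = false) : permg K k = 1 := by unfold permg; rw [if_neg (by rw [h]; decide)]

/-- `bG 0 = 0`. -/
theorem bG_zero : bG K d 0 = 0 := by unfold bG; rw [Nat.add_zero, sub_self]
/-- `cG 0 = 0`. -/
theorem cG_zero : cG K d 0 = 0 := by unfold cG; rw [if_pos rfl]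
/-- `cG y = Cg (k1 y) − aG (y−1)` for `y ≥ 1`. -/
theorem cG_pos {y : ℕ} (hy : y ≠ 0) : cG K d y = Cg K d (k1 K y) - aG K d (y - 1) := by unfold cG; rw [if_neg hy]
/-- `k1 y = 3y − 2` below the top class. -/
theorem k1_early {y : ℕ} (hy : y + 1 ≠ K) : k1 K y = 3 * y - 2 := by unfold k1; rw [if_neg hy]
include hK in
/-- `k1 (K−1) = 4K − 8`. -/
theorem k1_top : k1 K (K - 1) = 4 * K - 8 := by unfold k1; rw [if_pos (by omega)]
/-- `k2 x = 3x − 1` below the top class. -/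
theorem k2_early {x : ℕ} (hx : x + 1 ≠ K) : k2 K x = 3 * x - 1 := by unfold k2; rw [if_neg hx]
include hK in
/-- `k2 (K−1) = 4K − 7`. -/
theorem k2_top : k2 K (K - 1) = 4 * K - 7 := by unfold k2; rw [if_pos (by omega)]

/-- parity decides powers of `−1`. -/
theorem negOnePow_eq {a b : ℕ} (h : a % 2 = b % 2) : (-1 : ℤ) ^ a = (-1) ^ b := by
  rw [← Nat.mod_add_div a 2, ← Nat.mod_add_div b 2, pow_add, pow_add, pow_mul, pow_mul, h]; norm_num

/-- cost of chain term `k` is `Cg k`. -/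
theorem cost_termg (k : Fin (4 * K - 7 + 1)) : ∑ i, vg K d ((termg K hK k).1 i) i ((termg K hK k).2 i) = Cg K d k := by
  have hk : (k : ℕ) ≤ 4 * K - 7 := by have := k.isLt; omega
  rcases index_cases hK (k : ℕ) hk with h0 | ⟨j, hj, hjK, hkj⟩ | ⟨j, hj, hjK, hkj⟩ | ⟨j, hj, hjK, hkj⟩ |
      ⟨i, hi, hkj⟩ | hkj | hkj
  · obtain ⟨c0, c1, ns⟩ := cls_zero hK
    rw [costg_id d _ (by rw [termg_fst, h0]; exact permg_id ns)]
    show aG K d (g0 K k) + cG K d (g1 K k) = Cg K d k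
    rw [h0, c0, c1, cG_zero]; rfl
  · obtain ⟨c0, c1, sw⟩ := cls_sw_early (K := K) hj hjK
    rw [costg_swap d _ (by rw [termg_fst, hkj]; exact permg_sw sw)]
    show bG K d (g0 K k) + eG K d (g1 K k) = Cg K d k
    rw [hkj, c0, c1, bG_zero, zero_add]; rfl
  · obtain ⟨c0, c1, ns⟩ := cls_id1 (K := K) hj hjK
    rw [costg_id d _ (by rw [termg_fst, hkj]; exact permg_id ns)]
    show aG K d (g0 K k) + cG K d (g1 K k) = Cg K d k
    rw [hkj, c0, c1, cG_pos d (by omega), k1_early (by omega)]; ring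
  · obtain ⟨c0, c1, ns⟩ := cls_id2 (K := K) hj hjK
    rw [costg_id d _ (by rw [termg_fst, hkj]; exact permg_id ns)]
    show aG K d (g0 K k) + cG K d (g1 K k) = Cg K d k
    rw [hkj, c0, c1, cG_pos d (by omega), k1_early (by omega)]
    obtain ⟨j', rfl⟩ : ∃ j', j = j' + 1 := ⟨j - 1, by omega⟩
    rw [aG_succ, k2_early (by omega), k1_early (by omega), show j' + 1 - 1 = j' by omega]; ring
  · obtain ⟨c0, c1, sw⟩ := cls_sw_late hK hi
    rw [costg_swap d _ (by rw [termg_fst, hkj]; exact permg_sw sw)]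
    show bG K d (g0 K k) + eG K d (g1 K k) = Cg K d k
    rw [hkj, c0, c1]; unfold bG eG; rw [show 3 * (K - 1) - 3 = 3 * K - 6 by omega]; ring
  · obtain ⟨c0, c1, ns⟩ := cls_late1 hK
    rw [costg_id d _ (by rw [termg_fst, hkj]; exact permg_id ns)]
    show aG K d (g0 K k) + cG K d (g1 K k) = Cg K d k
    rw [hkj, c0, c1, cG_pos d (by omega), k1_top hK, show K - 1 - 1 = K - 2 by omega]; ring
  · obtain ⟨c0, c1, ns⟩ := cls_late2 hK
    rw [costg_id d _ (by rw [termg_fst, hkj]; exact permg_id ns)]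
    show aG K d (g0 K k) + cG K d (g1 K k) = Cg K d k
    rw [hkj, c0, c1, cG_pos d (by omega), k1_top hK, show K - 1 = K - 2 + 1 by omega, aG_succ,
      show K - 2 + 1 = K - 1 by omega, k2_top hK, k1_top hK, show K - 1 - 1 = K - 2 by omega]; ring

/-- sign of chain term `k` is `(−1)ᵏ`. -/
theorem termSign_termg (k : Fin (4 * K - 7 + 1)) : termSign (εg K) (termg K hK k) = (-1) ^ (k : ℕ) := by
  have hk : (k : ℕ) ≤ 4 * K - 7 := by have := k.isLt; omega
  rcases index_cases hK (k : ℕ) hk with h0 | ⟨j, hj, hjK, hkj⟩ | ⟨j, hj, hjK, hkj⟩ | ⟨j, hj, hjK, hkj⟩ |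
      ⟨i, hi, hkj⟩ | hkj | hkj
  · obtain ⟨c0, c1, ns⟩ := cls_zero hK
    rw [termSigng_id _ (by rw [termg_fst, h0]; exact permg_id ns), termg_cls0, termg_cls1, h0, c0, c1]; simp
  · obtain ⟨c0, c1, sw⟩ := cls_sw_early (K := K) hj hjK
    rw [termSigng_swap _ (by rw [termg_fst, hkj]; exact permg_sw sw), εg_10, εg_01, termg_cls0, termg_cls1, hkj, c0, c1,
      if_pos (by omega), if_pos hj, pow_zero, one_mul, ← neg_one_mul, ← pow_succ']
    exact negOnePow_eq (by omega)
  · obtain ⟨c0, c1, ns⟩ := cls_id1 (K := K) hj hjK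
    rw [termSigng_id _ (by rw [termg_fst, hkj]; exact permg_id ns), termg_cls0, termg_cls1, hkj, c0, c1,
      if_neg (by omega), if_neg (by omega), mul_neg_one, ← neg_one_mul, ← pow_succ']
    exact negOnePow_eq (by omega)
  · obtain ⟨c0, c1, ns⟩ := cls_id2 (K := K) hj hjK
    rw [termSigng_id _ (by rw [termg_fst, hkj]; exact permg_id ns), termg_cls0, termg_cls1, hkj, c0, c1,
      if_neg (by omega), if_neg (by omega), mul_neg_one, ← neg_one_mul, ← pow_succ']
    exact negOnePow_eq (by omega)
  · obtain ⟨c0, c1, sw⟩ := cls_sw_late hK hi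
    rw [termSigng_swap _ (by rw [termg_fst, hkj]; exact permg_sw sw), εg_10, εg_01, termg_cls0, termg_cls1, hkj, c0, c1,
      if_pos hi, if_pos (by omega), ← pow_add, ← neg_one_mul, ← pow_succ']
    exact negOnePow_eq (by omega)
  · obtain ⟨c0, c1, ns⟩ := cls_late1 hK
    rw [termSigng_id _ (by rw [termg_fst, hkj]; exact permg_id ns), termg_cls0, termg_cls1, hkj, c0, c1,
      if_neg (by omega), if_pos (by omega), ← pow_add]
    exact negOnePow_eq (by omega)
  · obtain ⟨c0, c1, ns⟩ := cls_late2 hK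
    rw [termSigng_id _ (by rw [termg_fst, hkj]; exact permg_id ns), termg_cls0, termg_cls1, hkj, c0, c1,
      if_neg (by omega), if_pos (by omega), ← pow_add]
    exact negOnePow_eq (by omega)

/-- chain terms are present. -/
theorem termSign_termg_ne_zero (k : Fin (4 * K - 7 + 1)) : termSign (εg K) (termg K hK k) ≠ 0 := by
  rw [termSign_termg]; exact pow_ne_zero _ (by norm_num)

/-- consecutive chain terms have opposite signs. -/
theorem alt_termg (k : Fin (4 * K - 7)) :
    termSign (εg K) (termg K hK k.castSucc) * termSign (εg K) (termg K hK k.succ) < 0 := by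
  rw [termSign_termg, termSign_termg, Fin.val_succ, Fin.val_castSucc, pow_succ]
  have h : ((-1 : ℤ) ^ (k : ℕ)) ^ 2 = 1 := by rw [← pow_mul, mul_comm, pow_mul]; norm_num
  nlinarith [h]

end chain
end TowerRowTwoGen

end Summit.ValiantsHypothesis.ValiantsHypothesis.Theorems.KPlusLogSqLaw.TowerGraft
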